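import Summits.PneNP.PneNP.Theorems.ConvexRankGatesLinAlgGateBlindValiantHypothesis

/-!
# Route ConvexRankGates — crux `LinAlgGateBlind` (stmt-PneNP-10681), support:
# the TAME re-typing of the GRANK half, written out in full, and what it still implies

Prover seat 1 (`--supports stmt-PneNP-10681`), planner-facing companion of
`ConvexRankGatesLinAlgGateBlindFixedField.lean` (the crux re-typed over one fixed field `F` still implies
`DcPerSuperpolynomial F` / `VNP_F ⊄ VBP_F`; not imported here). Here the TAME wide-gate class of the leads' recommendation
(`Cruxes/LinAlgGateBlind/PICKED.md`: "re-type GRANK TAME (`F = ℚ`/`𝔽_q`, entries of bit-size `≤ s`)") is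
written out in full — PERM gates on `≤ s` points; generic-rank threshold gates of dimension `≤ s` over `ℚ`
whose matrix entries are INTEGERS of absolute value `≤ 2^s`; generic-rank threshold gates of dimension `≤ s`
over `ZMod p` for primes `p ≤ 2^s` — and `TameBlind` denotes (always written out) the crux with its wide
gates restricted to that class. No new definitions. Results:

* `tameBlind_of_linAlgGateBlind` — the tame re-typing is a weakening of the crux;
* `dcPerSuperpolynomial_zmod_of_tameBlind` (registered sub-goal) — `TameBlind → DcPerSuperpolynomial (ZMod p)`
  for EVERY odd prime `p` (`p ≤ 2^{m^c}` eventually, so the `𝔽_p`-pencils of dimension `≤ m^c` are tame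
  gates): on its finite-field branch the tame re-typing is barrier C6 verbatim, Valiant's hypothesis in
  every odd characteristic;
* `dc_hcPoly_not_isPBounded_zmod_of_tameBlind` — and `VNP ⊄ VBP` over every prime field, `GF(2)` included;
* `not_exists_bitBounded_detRepr_of_tameBlind` (registered sub-goal) — the `ℚ`-branch: `TameBlind` implies that
  `CL_{m,⌈m^δ⌉₊}` is, for every `c` eventually, not the determinant of any affine `d × d` matrix over `ℚ`,
  `d ≤ m^c`, with INTEGER coefficients of absolute value `≤ 2^{m^c}` — a bit-bounded determinantal lower
  bound for an explicit family with 0/1 coefficients and a polynomial-time coefficient function (a `VNP⁰`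
  family), i.e. a constant-free Valiant-type separation of the kind `VNP⁰ ⊄ VBP⁰`; open in print (the
  constant-free theory: Malod 2003, Koiran 2005, Bürgisser 2009 "τ-conjecture ⇒ PER ∉ VP⁰"; the proved
  determinantal bounds are quadratic and constant-blind: Mignon–Ressayre 2004, Cai–Chen–Li 2010).

Reading for the planner: the tame re-typing of the GRANK half is NOT an escape from the algebraic-separation
floor of crux #4 — finite fields keep C6 itself, and the `ℚ`/`ℤ` bit-bounded remainder keeps a constant-free
Valiant-type floor no seat can discharge. What is left of crux #4 outside such floors is the Hall-cover / LP
layer (a corollary of crux #2, `hallCoverCircuitBlind_of_convexGateBlind`) and the PERM half. [folklore]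
-/

set_option linter.dupNamespace false  -- `Summit.PneNP.PneNP.…` is the harness-mandated namespace (summit = sub-problem)

namespace Summit.PneNP.PneNP.Theorems.LinAlgGateBlindTameRetyping

open Filter Matrix MvPolynomial Literature.Computability.Complexity
open Literature.Computability.AlgebraicComplexity
  (HasDetRepr DcPerSuperpolynomial IsPBounded hcPoly)
open Summit.PneNP.PneNP.Theorems.LinAlgGateBlind.Negative
  (cliquePoly shadow_cliquePoly_iff detGate_eq_true_iff)
open Summit.PneNP.PneNP.Theorems.LinAlgGateBlindValiant
  (isPBounded_dc_cliquePoly_of_perPoly isPBounded_dc_cliquePoly_of_hcPoly two_le_ceil_rpow_of_two_le)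
open Literature.Computability.AlgebraicComplexity (hasDetRepr_determinantalComplexity_holds)

noncomputable section

/-! ### Preliminaries: the certificate's `dc` step with the field recorded

(Same statements as `lt_dc_cliquePoly_of_pencilBlind` / `not_isPBounded_dc_cliquePoly_of_pencilBlind` of the
sibling file `ConvexRankGatesLinAlgGateBlindFixedField.lean`, proved here directly from the Negative-side
lemmas so that this file only imports `…ValiantHypothesis.lean`.) -/

/-- Pencil-blindness of `F` at `(m, c, k)`, `k ≥ 2` — no rank test over `F` of dimension `≤ m^c` wired to the
edges computes `CLIQUE(m,k)` — gives `m ^ c < dc (CL_{m,k})` over `F`: a determinantal representation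
`CL = det A` of size `d ≤ m^c` over `F` would be the rank test `K₀ = A(0)`, `Kᵢ = ∂A/∂Xᵢ`, `θ = d`.
[folklore] -/
theorem lt_dc_cliquePoly_of_pencilBlind' {F : Type} [Field F] {m c k : ℕ} (hk : 2 ≤ k)
    (h : ∀ (d θ n : ℕ), d ≤ m ^ c → ∀ (K₀ : Matrix (Fin d) (Fin d) F)
      (K : Fin n → Matrix (Fin d) (Fin d) F) (w : Fin n → (⊤ : SimpleGraph (Fin m)).edgeSet),
      ¬ ∀ x : (⊤ : SimpleGraph (Fin m)).edgeSet → Bool,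
        decide (θ ≤ (symbolicMatrix K₀ K fun a => x (w a)).rank) = cliqueFn m k x) :
    m ^ c < Literature.Computability.AlgebraicComplexity.determinantalComplexity (cliquePoly m F k) := by
  by_contra hle
  push Not at hle
  obtain ⟨A, hA, hdet⟩ := hasDetRepr_determinantalComplexity_holds (cliquePoly m F k)
  refine h _ (Literature.Computability.AlgebraicComplexity.determinantalComplexity (cliquePoly m F k)) _ hle
    (A.map (coeff 0)) (fun i => A.map (coeff (Finsupp.single i 1)))
    (fun i => (CliqueLPGate.eE m).symm i) fun x => ?_
  apply Bool.eq_iff_iff.2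
  rw [detGate_eq_true_iff A hA, hdet, shadow_cliquePoly_iff hk]

/-- Eventual pencil-blindness of `F` at `k = ⌈m^δ⌉₊`, for every `c ≥ 1`, forbids p-bounded
`dc(CL_{n,⌈n^δ⌉₊})` over `F` (`n ^ c + c ≤ n ^ (c+1)` for `n ≥ 2`). [folklore] -/
theorem not_isPBounded_dc_cliquePoly_of_pencilBlind' (F : Type) [Field F] {δ : ℝ} (hδ : 0 < δ)
    (h : ∀ c : ℕ, 1 ≤ c → ∀ᶠ m : ℕ in atTop, ∀ (d θ n : ℕ), d ≤ m ^ c →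
      ∀ (K₀ : Matrix (Fin d) (Fin d) F) (K : Fin n → Matrix (Fin d) (Fin d) F)
        (w : Fin n → (⊤ : SimpleGraph (Fin m)).edgeSet),
        ¬ ∀ x : (⊤ : SimpleGraph (Fin m)).edgeSet → Bool,
          decide (θ ≤ (symbolicMatrix K₀ K fun a => x (w a)).rank) = cliqueFn m ⌈(m : ℝ) ^ δ⌉₊ x) :
    ¬ IsPBounded fun n =>
      Literature.Computability.AlgebraicComplexity.determinantalComplexity (cliquePoly n F ⌈(n : ℝ) ^ δ⌉₊) := by
  rintro ⟨c, hc⟩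
  obtain ⟨n, hn, h2⟩ := ((h (c + 1) (by omega)).and (eventually_ge_atTop 2)).exists
  have hlt := lt_dc_cliquePoly_of_pencilBlind' (two_le_ceil_rpow_of_two_le hδ h2) hn
  have hpow : 2 ^ c ≤ n ^ c := Nat.pow_le_pow_left h2 c
  have hc2 : c < 2 ^ c := Nat.lt_two_pow_self
  have h1 : n ^ c + c ≤ n ^ (c + 1) :=
    calc n ^ c + c ≤ n ^ c + n ^ c := by omega
      _ = 2 * n ^ c := by ring
      _ ≤ n * n ^ c := Nat.mul_le_mul_right _ h2
      _ = n ^ (c + 1) := by ring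
  exact absurd ((hc n).trans h1) (not_le.2 hlt)

/-! ### The tame re-typing -/

/-- **The tame re-typing is a weakening of the crux** (`LinAlgGateBlind → TameBlind`: a tame gate over `ℚ`
or `ZMod p` is a GRANK gate of the crux with that witness field). [folklore] -/
theorem tameBlind_of_linAlgGateBlind (h : Summit.PneNP.PneNP.Theses.ConvexRankGates.LinAlgGateBlind) :
    ∃ δ : ℝ, 0 < δ ∧ δ < 1 / 2 ∧ ∀ c : ℕ, ∀ᶠ m : ℕ in atTop,
      ∀ C : Circuit ((⊤ : SimpleGraph (Fin m)).edgeSet),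
        C.IsOver ({GateFn.and 2, GateFn.or 2} ∪ {g : GateFn | IsPermGate (m ^ c) g ∨
          (∃ (d θ : ℕ), d ≤ m ^ c ∧ ∃ (K₀ : Matrix (Fin d) (Fin d) ℚ) (K : Fin g.1 → Matrix (Fin d) (Fin d) ℚ),
            (∀ a b, ∃ z : ℤ, K₀ a b = z ∧ z.natAbs ≤ 2 ^ (m ^ c)) ∧
            (∀ i a b, ∃ z : ℤ, K i a b = z ∧ z.natAbs ≤ 2 ^ (m ^ c)) ∧
            ∀ v : Fin g.1 → Bool, g.2 v = true ↔ θ ≤ (symbolicMatrix K₀ K v).rank) ∨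
          (∃ (p : ℕ) (_ : Fact p.Prime), p ≤ 2 ^ (m ^ c) ∧ ∃ (d θ : ℕ), d ≤ m ^ c ∧
            ∃ (K₀ : Matrix (Fin d) (Fin d) (ZMod p)) (K : Fin g.1 → Matrix (Fin d) (Fin d) (ZMod p)),
              ∀ v : Fin g.1 → Bool, g.2 v = true ↔ θ ≤ (symbolicMatrix K₀ K v).rank)}) →
        C.size ≤ m ^ c → ¬ C.Computes (cliqueFn m ⌈(m : ℝ) ^ δ⌉₊) := by
  obtain ⟨δ, hδ0, hδ1, hB⟩ := h
  refine ⟨δ, hδ0, hδ1, fun c => ?_⟩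
  filter_upwards [hB c] with m hm C hC hs
  refine hm C (hC.mono ?_) hs
  rintro g (hg | hg)
  · exact Or.inl hg
  · rcases hg with hg | ⟨d, θ, hd, K₀, K, -, -, hK⟩ | ⟨p, hp, -, d, θ, hd, K₀, K, hK⟩
    · exact Or.inr (Or.inl hg)
    · exact Or.inr (Or.inr ⟨ℚ, inferInstance, d, θ, hd, K₀, K, hK⟩)
    · exact Or.inr (Or.inr ⟨ZMod p, inferInstance, d, θ, hd, K₀, K, hK⟩)

/-- `p ≤ 2 ^ (m ^ c)` eventually in `m`, for `c ≥ 1`. [folklore] -/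
theorem eventually_le_two_pow_pow (p c : ℕ) (hc : 1 ≤ c) : ∀ᶠ m : ℕ in atTop, p ≤ 2 ^ (m ^ c) := by
  filter_upwards [eventually_ge_atTop p, eventually_ge_atTop 1] with m hm h1
  calc p ≤ m := hm
    _ = m ^ 1 := (pow_one m).symm
    _ ≤ m ^ c := Nat.pow_le_pow_right h1 hc
    _ ≤ 2 ^ (m ^ c) := Nat.lt_two_pow_self.le

/-- **`TameBlind` gives eventual pencil-blindness of `ZMod p` for EVERY prime `p`, at every `c ≥ 1`**
(`p ≤ 2^{m^c}` eventually, so an `𝔽_p`-rank test of dimension `≤ m^c` wired to the edges is a size-`1`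
circuit over the tame basis). [folklore] -/
theorem pencilBlind_zmod_of_tameBlind
    (h : ∃ δ : ℝ, 0 < δ ∧ δ < 1 / 2 ∧ ∀ c : ℕ, ∀ᶠ m : ℕ in atTop,
      ∀ C : Circuit ((⊤ : SimpleGraph (Fin m)).edgeSet),
        C.IsOver ({GateFn.and 2, GateFn.or 2} ∪ {g : GateFn | IsPermGate (m ^ c) g ∨
          (∃ (d θ : ℕ), d ≤ m ^ c ∧ ∃ (K₀ : Matrix (Fin d) (Fin d) ℚ) (K : Fin g.1 → Matrix (Fin d) (Fin d) ℚ),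
            (∀ a b, ∃ z : ℤ, K₀ a b = z ∧ z.natAbs ≤ 2 ^ (m ^ c)) ∧
            (∀ i a b, ∃ z : ℤ, K i a b = z ∧ z.natAbs ≤ 2 ^ (m ^ c)) ∧
            ∀ v : Fin g.1 → Bool, g.2 v = true ↔ θ ≤ (symbolicMatrix K₀ K v).rank) ∨
          (∃ (p : ℕ) (_ : Fact p.Prime), p ≤ 2 ^ (m ^ c) ∧ ∃ (d θ : ℕ), d ≤ m ^ c ∧
            ∃ (K₀ : Matrix (Fin d) (Fin d) (ZMod p)) (K : Fin g.1 → Matrix (Fin d) (Fin d) (ZMod p)),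
              ∀ v : Fin g.1 → Bool, g.2 v = true ↔ θ ≤ (symbolicMatrix K₀ K v).rank)}) →
        C.size ≤ m ^ c → ¬ C.Computes (cliqueFn m ⌈(m : ℝ) ^ δ⌉₊)) :
    ∃ δ : ℝ, 0 < δ ∧ δ < 1 / 2 ∧ ∀ (p : ℕ) [Fact p.Prime] (c : ℕ), 1 ≤ c →
      ∀ᶠ m : ℕ in atTop, ∀ (d θ n : ℕ), d ≤ m ^ c →
        ∀ (K₀ : Matrix (Fin d) (Fin d) (ZMod p)) (K : Fin n → Matrix (Fin d) (Fin d) (ZMod p))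
          (w : Fin n → (⊤ : SimpleGraph (Fin m)).edgeSet),
          ¬ ∀ x : (⊤ : SimpleGraph (Fin m)).edgeSet → Bool,
            decide (θ ≤ (symbolicMatrix K₀ K fun a => x (w a)).rank) = cliqueFn m ⌈(m : ℝ) ^ δ⌉₊ x := by
  obtain ⟨δ, hδ0, hδ1, hB⟩ := h
  refine ⟨δ, hδ0, hδ1, fun p _ c hc => ?_⟩
  filter_upwards [hB c, eventually_ge_atTop 1, eventually_le_two_pow_pow p c hc] with
    m hm h1 hp d θ n hd K₀ K w hcomp
  let B : Set GateFn := {GateFn.and 2, GateFn.or 2} ∪ {g : GateFn | IsPermGate (m ^ c) g ∨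
    (∃ (d θ : ℕ), d ≤ m ^ c ∧ ∃ (K₀ : Matrix (Fin d) (Fin d) ℚ) (K : Fin g.1 → Matrix (Fin d) (Fin d) ℚ),
      (∀ a b, ∃ z : ℤ, K₀ a b = z ∧ z.natAbs ≤ 2 ^ (m ^ c)) ∧
      (∀ i a b, ∃ z : ℤ, K i a b = z ∧ z.natAbs ≤ 2 ^ (m ^ c)) ∧
      ∀ v : Fin g.1 → Bool, g.2 v = true ↔ θ ≤ (symbolicMatrix K₀ K v).rank) ∨
    (∃ (p : ℕ) (_ : Fact p.Prime), p ≤ 2 ^ (m ^ c) ∧ ∃ (d θ : ℕ), d ≤ m ^ c ∧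
      ∃ (K₀ : Matrix (Fin d) (Fin d) (ZMod p)) (K : Fin g.1 → Matrix (Fin d) (Fin d) (ZMod p)),
        ∀ v : Fin g.1 → Bool, g.2 v = true ↔ θ ≤ (symbolicMatrix K₀ K v).rank)}
  let g : GateFn := ⟨n, fun v => decide (θ ≤ (symbolicMatrix K₀ K v).rank)⟩
  have hg : g ∈ B := Or.inr (Or.inr (Or.inr ⟨p, inferInstance, hp, d, θ, hd, K₀, K, fun v => decide_eq_true_iff⟩))
  obtain ⟨C, hC, hsz, he⟩ := (CktSize.gate (B := B) g hg w).toCircuit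
  exact hm C hC (hsz.trans (Nat.one_le_pow _ _ h1)) fun x => (he x).trans (hcomp x)

/-- **The tame re-typing implies Valiant's hypothesis over EVERY prime field of odd characteristic**
(registered sub-goal `dcPerSuperpolynomial_zmod_of_tameBlind` of stmt-PneNP-10681): `TameBlind →
DcPerSuperpolynomial (ZMod p)` for every odd prime `p` — "re-type GRANK tame" does not leave barrier C6 as long
as finite fields are admitted. [folklore] -/
theorem dcPerSuperpolynomial_zmod_of_tameBlind : (∃ δ : ℝ, 0 < δ ∧ δ < 1 / 2 ∧ ∀ c : ℕ, ∀ᶠ m : ℕ in atTop, ∀ C : Circuit ((⊤ : SimpleGraph (Fin m)).edgeSet), C.IsOver ({GateFn.and 2, GateFn.or 2} ∪ {g : GateFn | IsPermGate (m ^ c) g ∨ (∃ (d θ : ℕ), d ≤ m ^ c ∧ ∃ (K₀ : Matrix (Fin d) (Fin d) ℚ) (K : Fin g.1 → Matrix (Fin d) (Fin d) ℚ), (∀ a b, ∃ z : ℤ, K₀ a b = z ∧ z.natAbs ≤ 2 ^ (m ^ c)) ∧ (∀ i a b, ∃ z : ℤ, K i a b = z ∧ z.natAbs ≤ 2 ^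 (m ^ c)) ∧ ∀ v : Fin g.1 → Bool, g.2 v = true ↔ θ ≤ (symbolicMatrix K₀ K v).rank) ∨ (∃ (p : ℕ) (_ : Fact p.Prime), p ≤ 2 ^ (m ^ c) ∧ ∃ (d θ : ℕ), d ≤ m ^ c ∧ ∃ (K₀ : Matrix (Fin d) (Fin d) (ZMod p)) (K : Fin g.1 → Matrix (Fin d) (Fin d) (ZMod p)), ∀ v : Fin g.1 → Bool, g.2 v = true ↔ θ ≤ (symbolicMatrix K₀ K v).rank)}) → C.size ≤ m ^ c → ¬ C.Computes (cliqueFn m ⌈(m : ℝ) ^ δ⌉₊)) → ∀ (p : ℕ) [Fact p.Prime], p ≠ 2 → DcPerSuperpolynomial (ZMod p) := by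
  intro h p _ hp hper
  obtain ⟨δ, hδ0, -, hB⟩ := pencilBlind_zmod_of_tameBlind h
  have h2 : ringChar (ZMod p) ≠ 2 := by rwa [ZMod.ringChar_zmod_n]
  exact not_isPBounded_dc_cliquePoly_of_pencilBlind' (ZMod p) hδ0 (hB p)
    (isPBounded_dc_cliquePoly_of_perPoly (ZMod p) h2 _ (fun _ hn => two_le_ceil_rpow_of_two_le hδ0 hn) hper)

/-- **… and `VNP ⊄ VBP` over every prime field**, `GF(2)` included: `TameBlind →` `dc(HC_n)` over `ZMod p`
is not polynomially bounded, for every prime `p`. [folklore] -/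
theorem dc_hcPoly_not_isPBounded_zmod_of_tameBlind
    (h : ∃ δ : ℝ, 0 < δ ∧ δ < 1 / 2 ∧ ∀ c : ℕ, ∀ᶠ m : ℕ in atTop,
      ∀ C : Circuit ((⊤ : SimpleGraph (Fin m)).edgeSet),
        C.IsOver ({GateFn.and 2, GateFn.or 2} ∪ {g : GateFn | IsPermGate (m ^ c) g ∨
          (∃ (d θ : ℕ), d ≤ m ^ c ∧ ∃ (K₀ : Matrix (Fin d) (Fin d) ℚ) (K : Fin g.1 → Matrix (Fin d) (Fin d) ℚ),
            (∀ a b, ∃ z : ℤ, K₀ a b = z ∧ z.natAbs ≤ 2 ^ (m ^ c)) ∧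
            (∀ i a b, ∃ z : ℤ, K i a b = z ∧ z.natAbs ≤ 2 ^ (m ^ c)) ∧
            ∀ v : Fin g.1 → Bool, g.2 v = true ↔ θ ≤ (symbolicMatrix K₀ K v).rank) ∨
          (∃ (p : ℕ) (_ : Fact p.Prime), p ≤ 2 ^ (m ^ c) ∧ ∃ (d θ : ℕ), d ≤ m ^ c ∧
            ∃ (K₀ : Matrix (Fin d) (Fin d) (ZMod p)) (K : Fin g.1 → Matrix (Fin d) (Fin d) (ZMod p)),
              ∀ v : Fin g.1 → Bool, g.2 v = true ↔ θ ≤ (symbolicMatrix K₀ K v).rank)}) →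
        C.size ≤ m ^ c → ¬ C.Computes (cliqueFn m ⌈(m : ℝ) ^ δ⌉₊))
    (p : ℕ) [Fact p.Prime] :
    ¬ IsPBounded fun n =>
      Literature.Computability.AlgebraicComplexity.determinantalComplexity (hcPoly (Fin n) (ZMod p)) :=
  fun hhc => by
  obtain ⟨δ, hδ0, -, hB⟩ := pencilBlind_zmod_of_tameBlind h
  exact not_isPBounded_dc_cliquePoly_of_pencilBlind' (ZMod p) hδ0 (hB p)
    (isPBounded_dc_cliquePoly_of_hcPoly (ZMod p) _ (fun _ hn => two_le_ceil_rpow_of_two_le hδ0 hn) hhc)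

/-- **The `ℚ`-branch, pointwise and with the minimal hypothesis.** If at `(m, c, k)`, `k ≥ 2`, no rank test
over `ℚ` of dimension `≤ m^c` whose data have INTEGER entries of absolute value `≤ 2^{m^c}`, wired to the edges,
computes `CLIQUE(m, k)`, then `CL_{m,k}` is not the determinant of any affine `d × d` matrix over `ℚ`,
`d ≤ m^c`, with integer coefficients of absolute value `≤ 2^{m^c}`: `K₀ = A(0)`, `Kᵢ = ∂A/∂Xᵢ` inherit the
coefficients of `A`, so the representation would be such a test. [folklore] -/
theorem not_exists_bitBounded_detRepr_of_pencilBlind {m c k : ℕ} (hk : 2 ≤ k)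
    (h : ∀ (d θ n : ℕ), d ≤ m ^ c → ∀ (K₀ : Matrix (Fin d) (Fin d) ℚ) (K : Fin n → Matrix (Fin d) (Fin d) ℚ),
      (∀ a b, ∃ z : ℤ, K₀ a b = z ∧ z.natAbs ≤ 2 ^ (m ^ c)) →
      (∀ i a b, ∃ z : ℤ, K i a b = z ∧ z.natAbs ≤ 2 ^ (m ^ c)) →
      ∀ (w : Fin n → (⊤ : SimpleGraph (Fin m)).edgeSet),
        ¬ ∀ x : (⊤ : SimpleGraph (Fin m)).edgeSet → Bool,
          decide (θ ≤ (symbolicMatrix K₀ K fun a => x (w a)).rank) = cliqueFn m k x)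
    {d : ℕ} (hd : d ≤ m ^ c) :
    ¬ ∃ A : Matrix (Fin d) (Fin d) (MvPolynomial (Fin (CliqueLPGate.nE m)) ℚ),
      (∀ a b, (A a b).totalDegree ≤ 1) ∧
      (∀ a b (s : Fin (CliqueLPGate.nE m) →₀ ℕ), ∃ z : ℤ, (A a b).coeff s = z ∧ z.natAbs ≤ 2 ^ (m ^ c)) ∧
      A.det = cliquePoly m ℚ k := by
  rintro ⟨A, hA, hZ, hdet⟩
  refine h d d _ hd (A.map (coeff 0)) (fun i => A.map (coeff (Finsupp.single i 1)))
    (fun a b => hZ a b 0) (fun i a b => hZ a b _) (fun i => (CliqueLPGate.eE m).symm i) fun x => ?_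
  apply Bool.eq_iff_iff.2
  rw [detGate_eq_true_iff A hA, hdet, shadow_cliquePoly_iff hk]

/-- **The `ℚ`-branch: the tame re-typing implies a BIT-BOUNDED determinantal lower bound for the clique
polynomials** (registered sub-goal `not_exists_bitBounded_detRepr_of_tameBlind` of stmt-PneNP-10681).
`TameBlind` gives: for its `δ` and every `c`, eventually in `m`, `CL_{m,⌈m^δ⌉₊}` is not the determinant of any
affine `d × d` matrix over `ℚ`, `d ≤ m^c`, all of whose coefficients are INTEGERS of absolute value
`≤ 2^{m^c}` — such a representation would be one tame rank test over `ℚ` computing CLIQUE (`K₀ = A(0)`,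
`Kᵢ = ∂A/∂Xᵢ` inherit the coefficients). A constant-free Valiant-type separation, open in print. [folklore] -/
theorem not_exists_bitBounded_detRepr_of_tameBlind : (∃ δ : ℝ, 0 < δ ∧ δ < 1 / 2 ∧ ∀ c : ℕ, ∀ᶠ m : ℕ in atTop, ∀ C : Circuit ((⊤ : SimpleGraph (Fin m)).edgeSet), C.IsOver ({GateFn.and 2, GateFn.or 2} ∪ {g : GateFn | IsPermGate (m ^ c) g ∨ (∃ (d θ : ℕ), d ≤ m ^ c ∧ ∃ (K₀ : Matrix (Fin d) (Fin d) ℚ) (K : Fin g.1 → Matrix (Fin d) (Fin d) ℚ), (∀ a b, ∃ z : ℤ, K₀ a b = z ∧ z.natAbs ≤ 2 ^ (m ^ c)) ∧ (∀ i a b, ∃ z : ℤ, K i a b = z ∧ z.natAbs ≤ 2 ^ (m ^ c)) ∧ ∀ v : Fin g.1 → Bool, g.2 v = true ↔ θ ≤ (symbolicMatrix K₀ K v).rank) ∨ (∃ (p : ℕ) (_ : Fact p.Prime), p ≤ 2 ^ (m ^ c) ∧ ∃ (d θ : ℕ), d ≤ m ^ c ∧ ∃ (K₀ : Matrix (Fin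 d) (Fin d) (ZMod p)) (K : Fin g.1 → Matrix (Fin d) (Fin d) (ZMod p)), ∀ v : Fin g.1 → Bool, g.2 v = true ↔ θ ≤ (symbolicMatrix K₀ K v).rank)}) → C.size ≤ m ^ c → ¬ C.Computes (cliqueFn m ⌈(m : ℝ) ^ δ⌉₊)) → ∃ δ : ℝ, 0 < δ ∧ δ < 1 / 2 ∧ ∀ c : ℕ, ∀ᶠ m : ℕ in atTop, ∀ d ≤ m ^ c, ¬ ∃ A : Matrix (Fin d) (Fin d) (MvPolynomial (Fin (CliqueLPGate.nE m)) ℚ), (∀ a b, (A a b).totalDegree ≤ 1) ∧ (∀ a b (s : Fin (CliqueLPGate.nE m) →₀ ℕ), ∃ z : ℤ, (A a b).coeff s = z ∧ z.natAbs ≤ 2 ^ (m ^ c)) ∧ A.det = cliquePoly m ℚ ⌈(m : ℝ) ^ δ⌉₊ := by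
  rintro ⟨δ, hδ0, hδ1, hB⟩
  refine ⟨δ, hδ0, hδ1, fun c => ?_⟩
  filter_upwards [hB c, eventually_ge_atTop 2] with m hm h2 d hd
  refine not_exists_bitBounded_detRepr_of_pencilBlind (two_le_ceil_rpow_of_two_le hδ0 h2) ?_ hd
  -- a tame rank test over `ℚ` wired to the edges is a size-1 circuit over the tame basis
  intro d θ n hd K₀ K hK₀ hK w hcomp
  let B : Set GateFn := {GateFn.and 2, GateFn.or 2} ∪ {g : GateFn | IsPermGate (m ^ c) g ∨
    (∃ (d θ : ℕ), d ≤ m ^ c ∧ ∃ (K₀ : Matrix (Fin d) (Fin d) ℚ) (K : Fin g.1 → Matrix (Fin d) (Fin d) ℚ),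
      (∀ a b, ∃ z : ℤ, K₀ a b = z ∧ z.natAbs ≤ 2 ^ (m ^ c)) ∧
      (∀ i a b, ∃ z : ℤ, K i a b = z ∧ z.natAbs ≤ 2 ^ (m ^ c)) ∧
      ∀ v : Fin g.1 → Bool, g.2 v = true ↔ θ ≤ (symbolicMatrix K₀ K v).rank) ∨
    (∃ (p : ℕ) (_ : Fact p.Prime), p ≤ 2 ^ (m ^ c) ∧ ∃ (d θ : ℕ), d ≤ m ^ c ∧
      ∃ (K₀ : Matrix (Fin d) (Fin d) (ZMod p)) (K : Fin g.1 → Matrix (Fin d) (Fin d) (ZMod p)),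
        ∀ v : Fin g.1 → Bool, g.2 v = true ↔ θ ≤ (symbolicMatrix K₀ K v).rank)}
  let g : GateFn := ⟨n, fun v => decide (θ ≤ (symbolicMatrix K₀ K v).rank)⟩
  have hg : g ∈ B := Or.inr (Or.inr (Or.inl ⟨d, θ, hd, K₀, K, hK₀, hK, fun v => decide_eq_true_iff⟩))
  obtain ⟨C, hC, hsz, he⟩ := (CktSize.gate (B := B) g hg w).toCircuit
  exact hm C hC (hsz.trans (Nat.one_le_pow _ _ (by omega))) fun x => (he x).trans (hcomp x)

end

end Summit.PneNP.PneNP.Theorems.LinAlgGateBlindTameRetyping
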